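import Mathlib.Algebra.Homology.DerivedCategory.Ext.ExactSequences
import Mathlib.CategoryTheory.Sites.SheafCohomology.Basic
import HarnessLib

/-!
# `Ext`-groups into a quotient `X/X'` by a subobject: Bockstein vanishing and tower surjectivity

Let `C` be an abelian category (with `HasExt.{w} C`, Mathlib's `Ext` via the derived category),
`A : C` an object of coefficients, and `f : X' ⟶ X` a monomorphism with its canonical cokernel
`X ⟶ cokernel f` ("`X/X'`"). From Mathlib's covariant long exact `Ext` sequence of the short exact
sequence `0 → X' → X → X/X' → 0` (`Ext.covariantSequence_exact`) we read off, in the language a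
user of sheaf cohomology wants (`Sheaf.H F n = Extⁿ(ℤ, F)`, `Sheaf.H.map f n x = x.comp (mk₀ f) _`):

* the three exactness statements as `iff`s (`comp_mk₀_cokernel_π_eq_zero_iff`: the kernel of
  `Extⁿ(A, X) → Extⁿ(A, X/X')` is the image of `Extⁿ(A, X')`; `comp_extClass_eq_zero_iff`;
  `comp_mk₀_eq_zero_iff_exists_comp_extClass`);
* **Bockstein vanishing** (`comp_extClass_eq_zero_of_injective`): if `f_*` is injective on
  `Extⁿ⁺¹(A, X') → Extⁿ⁺¹(A, X)` then the connecting map `Extⁿ(A, X/X') → Extⁿ⁺¹(A, X')` is zero,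
  hence `Extⁿ(A, X) → Extⁿ(A, X/X')` is ONTO (`comp_mk₀_cokernel_π_surjective_of_injective`), and
  so is `Extⁿ(A, Y) → Extⁿ(A, X/X')` for every factorisation `X ⟶ Y ⟶ X/X'` of the projection
  (`comp_mk₀_surjective_of_fac`) — the transition maps of a tower of quotients `X/X'' → X/X'`,
  `X'' ⊆ X' ⊆ X`;
* the case of MULTIPLICATION BY AN INTEGER `q` (`f = q • 𝟙 X` mono, i.e. `X` without `q`-torsion):
  post-composition with `q • 𝟙 X` is multiplication by `q` on `Ext` (`comp_mk₀_zsmul_id`);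
  `X/qᵐX := cokernel (qᵐ • 𝟙 X)`; `Extⁿ(A, X/qᵐX)` is killed by `qᵐ` (`pow_zsmul_ext_cokernel_eq_zero`,
  no hypothesis); the kernel of `Extⁿ(A, X) → Extⁿ(A, X/qᵐX)` is `qᵐ · Extⁿ(A, X)`
  (`comp_mk₀_cokernel_π_pow_eq_zero_iff`); and if `Extⁿ⁺¹(A, X)` has no `q`-torsion then
  `Extⁿ(A, X) → Extⁿ(A, X/qᵐX)` and all transition maps `Extⁿ(A, X/q^{m'}X) → Extⁿ(A, X/qᵐX)`
  (`m ≤ m'`) are onto (`comp_mk₀_cokernel_π_pow_surjective`, `comp_mk₀_transition_pow_surjective`),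
  i.e. `Extⁿ(A, X/qᵐX) ≅ Extⁿ(A, X)/qᵐ` with the obvious surjective transition maps;
* the same four statements for Mathlib's sheaf cohomology `Sheaf.H` / `Sheaf.H.map` of an abelian
  sheaf `F` without `q`-torsion on any site (`Sheaf.H.map_cokernel_π_pow_surjective`, …), by `rfl`.

This is the coherent-cohomology bookkeeping behind "cohomology and base change along the `p`-adic
tower": for `𝒳` flat over `W(k)` one has `𝒪_{X_m} = 𝒪_𝒳/pᵐ` as abelian sheaves on `|𝒳|`, so that
`p`-torsion-freeness of `H^{b+1}(𝒳, 𝒪_𝒳)` gives `H^b(X_m, 𝒪) = H^b(𝒳, 𝒪)/pᵐ` with surjective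
transition maps `H^b(X_{m+1}, 𝒪) ↠ H^b(X_m, 𝒪)` (Bloch–Esnault–Kerz 2014, §8; Berthelot–Ogus 1983,
proof of Thm. 3.8). The identification of `𝒪_{X_m}` with the cokernel sheaf is scheme theory and
is NOT in this file; neither is the short exact sequence `0 → X'/X'' → X/X'' → X/X' → 0`.

## References

* C. A. Weibel, *An introduction to homological algebra*, CUP (1994), Thm. 1.3.1 and §3.4
  (long exact `Ext` sequence). [`Weibel1994`]
* R. Hartshorne, *Algebraic Geometry*, GTM 52 (1977), III Prop. 6.4 / Thm. 1.1A (long exact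
  sequence of `Ext` and of cohomology). [`Hartshorne1977`]
-/

universe w' w v u

open CategoryTheory CategoryTheory.Limits CategoryTheory.Abelian

namespace Literature.Algebra.Homology

variable {C : Type u} [Category.{v} C] [Abelian C] [HasExt.{w} C]

/-! ## 1. One monomorphism `f : X' ⟶ X` -/

section Mono

variable {X' X : C} (f : X' ⟶ X) [Mono f]

omit [HasExt.{w} C] in
/-- For a monomorphism `f : X' ⟶ X`, the sequence `0 → X' →f X → cokernel f → 0` is short exact
(Weibel 1994, Def. 1.2.2 / Ex. 1.2.3). The short complex is spelled
`ShortComplex.mk f (cokernel.π f) _` (rather than Mathlib's `ShortComplex.cokernelSequence f`) so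
that its three objects reduce to `X'`, `X`, `cokernel f` by projection reduction. [folklore] -/
lemma shortExact_mk_cokernel :
    (ShortComplex.mk f (cokernel.π f) (cokernel.condition f)).ShortExact :=
  ShortComplex.ShortExact.mk' (ShortComplex.cokernelSequence_exact f)
    (inferInstanceAs (Mono f)) (inferInstanceAs (Epi (cokernel.π f)))

variable (A : C) {n : ℕ}

/-- Exactness of `Extⁿ(A, X') → Extⁿ(A, X) → Extⁿ(A, X/X')` as an `iff`: a class on `X` dies in
the quotient `cokernel f` iff it comes from the subobject `X'` (Weibel 1994, Thm. 1.3.1 for the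
derived functors `Extⁿ(A, -)`). [folklore] -/
lemma comp_mk₀_cokernel_π_eq_zero_iff (x : Ext A X n) :
    x.comp (Ext.mk₀ (cokernel.π f)) (add_zero n) = 0 ↔
      ∃ x' : Ext A X' n, x'.comp (Ext.mk₀ f) (add_zero n) = x := by
  constructor
  · intro hx
    exact Ext.covariant_sequence_exact₂ A (shortExact_mk_cokernel f) x hx
  · rintro ⟨x', rfl⟩
    rw [Ext.comp_assoc_of_third_deg_zero, Ext.mk₀_comp_mk₀, cokernel.condition, Ext.mk₀_zero,
      Ext.comp_zero]

/-- Exactness of `Extⁿ(A, X) → Extⁿ(A, X/X') →δ Extⁿ⁺¹(A, X')` as an `iff`: the connecting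
homomorphism (composition with the class `extClass ∈ Ext¹(X/X', X')` of the extension) kills a
class iff that class comes from `X` (Weibel 1994, Thm. 1.3.1). [folklore] -/
lemma comp_extClass_eq_zero_iff (y : Ext A (cokernel f) n) :
    y.comp (shortExact_mk_cokernel f).extClass (rfl : n + 1 = n + 1) = 0 ↔
      ∃ x : Ext A X n, x.comp (Ext.mk₀ (cokernel.π f)) (add_zero n) = y := by
  constructor
  · intro hy
    exact Ext.covariant_sequence_exact₃ A (shortExact_mk_cokernel f) y (n₁ := n + 1) rfl hy
  · rintro ⟨x, rfl⟩
    rw [Ext.comp_assoc_of_second_deg_zero]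
    rw [(shortExact_mk_cokernel f).comp_extClass]
    rw [Ext.comp_zero]

/-- Exactness of `Extⁿ(A, X/X') →δ Extⁿ⁺¹(A, X') → Extⁿ⁺¹(A, X)` as an `iff`: a class on `X'`
dies on `X` iff it is a Bockstein, i.e. in the image of the connecting homomorphism
(Weibel 1994, Thm. 1.3.1). [folklore] -/
lemma comp_mk₀_eq_zero_iff_exists_comp_extClass (x₁ : Ext A X' (n + 1)) :
    x₁.comp (Ext.mk₀ f) (add_zero (n + 1)) = 0 ↔
      ∃ y : Ext A (cokernel f) n,
        y.comp (shortExact_mk_cokernel f).extClass (rfl : n + 1 = n + 1) = x₁ := by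
  constructor
  · intro hx
    exact Ext.covariant_sequence_exact₁ A (shortExact_mk_cokernel f) x₁ hx (n₀ := n) rfl
  · rintro ⟨y, rfl⟩
    rw [Ext.comp_assoc_of_third_deg_zero]
    rw [(shortExact_mk_cokernel f).extClass_comp]
    rw [Ext.comp_zero]

/-- **Bockstein vanishing.** If post-composition with the monomorphism `f` is injective on
`Extⁿ⁺¹(A, X') → Extⁿ⁺¹(A, X)` ("`Extⁿ⁺¹(A, X')` has no `f`-torsion"), then the connecting
homomorphism `Extⁿ(A, X/X') → Extⁿ⁺¹(A, X')` of `0 → X' → X → X/X' → 0` vanishes: its image is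
the kernel of `f_*` (Bloch–Esnault–Kerz 2014, §8, the vanishing of Bocksteins under
torsion-freeness; Weibel 1994, Thm. 1.3.1). [folklore] -/
lemma comp_extClass_eq_zero_of_injective
    (hf : Function.Injective
      (fun x₁ : Ext A X' (n + 1) => x₁.comp (Ext.mk₀ f) (add_zero (n + 1))))
    (y : Ext A (cokernel f) n) :
    y.comp (shortExact_mk_cokernel f).extClass (rfl : n + 1 = n + 1) = 0 := by
  apply hf
  dsimp only
  rw [Ext.zero_comp, Ext.comp_assoc_of_third_deg_zero]
  rw [(shortExact_mk_cokernel f).extClass_comp]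
  rw [Ext.comp_zero]

/-- **Surjectivity onto the quotient.** If `f_*` is injective on `Extⁿ⁺¹(A, X') → Extⁿ⁺¹(A, X)`,
then every class in `Extⁿ(A, X/X')` is the image of a class in `Extⁿ(A, X)`: the Bockstein
vanishes (`comp_extClass_eq_zero_of_injective`) and the sequence is exact at `Extⁿ(A, X/X')`.
[folklore] -/
lemma comp_mk₀_cokernel_π_surjective_of_injective
    (hf : Function.Injective
      (fun x₁ : Ext A X' (n + 1) => x₁.comp (Ext.mk₀ f) (add_zero (n + 1)))) :
    Function.Surjective (fun x : Ext A X n => x.comp (Ext.mk₀ (cokernel.π f)) (add_zero n)) :=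
  fun y => (comp_extClass_eq_zero_iff f A y).1 (comp_extClass_eq_zero_of_injective f A hf y)

/-- **Surjectivity of transition maps.** If `f_*` is injective on `Extⁿ⁺¹(A, X') → Extⁿ⁺¹(A, X)`,
then for every factorisation `X ⟶ Y ⟶ X/X'` of the projection `X ⟶ X/X' = cokernel f` (e.g.
`Y = X/X''` for a smaller subobject `X'' ⊆ X'`, the transition map of a tower of quotients), the
map `Extⁿ(A, Y) → Extⁿ(A, X/X')` is onto. [folklore] -/
lemma comp_mk₀_surjective_of_fac {Y : C} (π' : X ⟶ Y) (t : Y ⟶ cokernel f)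
    (fac : π' ≫ t = cokernel.π f)
    (hf : Function.Injective
      (fun x₁ : Ext A X' (n + 1) => x₁.comp (Ext.mk₀ f) (add_zero (n + 1)))) :
    Function.Surjective (fun y' : Ext A Y n => y'.comp (Ext.mk₀ t) (add_zero n)) := by
  intro y
  obtain ⟨x, rfl⟩ := comp_mk₀_cokernel_π_surjective_of_injective f A hf y
  refine ⟨x.comp (Ext.mk₀ π') (add_zero n), ?_⟩
  dsimp only
  rw [Ext.comp_assoc_of_third_deg_zero, Ext.mk₀_comp_mk₀, fac]

end Mono

/-! ## 2. Multiplication by an integer `q` on an object without `q`-torsion -/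

section Scalar

variable (A X : C) {n : ℕ}

/-- Post-composition with `q • 𝟙 X` on `Extⁿ(A, X)` is multiplication by the integer `q`
(bi-additivity of the Yoneda composition). [folklore] -/
lemma comp_mk₀_zsmul_id (q : ℤ) (x : Ext A X n) :
    x.comp (Ext.mk₀ (q • 𝟙 X)) (add_zero n) = q • x := by
  let h : (X ⟶ X) →+ Ext A X n :=
    AddMonoidHom.mk' (fun φ => x.comp (Ext.mk₀ φ) (add_zero n)) (fun φ ψ => by
      simp only [Ext.mk₀_add, Ext.comp_add])
  have h1 : h (𝟙 X) = x := Ext.comp_mk₀_id x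
  calc x.comp (Ext.mk₀ (q • 𝟙 X)) (add_zero n) = h (q • 𝟙 X) := rfl
    _ = q • h (𝟙 X) := map_zsmul h q (𝟙 X)
    _ = q • x := by rw [h1]

/-- `Extⁿ(A, X)` has no `q`-torsion iff post-composition with `q • 𝟙 X` is injective on it.
[folklore] -/
lemma comp_mk₀_zsmul_id_injective_iff (q : ℤ) :
    Function.Injective (fun x : Ext A X n => x.comp (Ext.mk₀ (q • 𝟙 X)) (add_zero n)) ↔
      ∀ x : Ext A X n, q • x = 0 → x = 0 := by
  simp_rw [comp_mk₀_zsmul_id]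
  constructor
  · intro h x hx
    exact h (show q • x = q • (0 : Ext A X n) by rw [hx, smul_zero])
  · intro h x y hxy
    have hq : q • (x - y) = 0 := by
      have hxy' : q • x = q • y := hxy
      rw [smul_sub, hxy', sub_self]
    exact sub_eq_zero.1 (h _ hq)

omit [HasExt.{w} C] in
/-- `(q • 𝟙 X) ≫ (r • 𝟙 X) = (r * q) • 𝟙 X`. [folklore] -/
lemma zsmul_id_comp_zsmul_id (q r : ℤ) : (q • 𝟙 X) ≫ (r • 𝟙 X) = (r * q) • 𝟙 X := by
  rw [Preadditive.zsmul_comp, Category.id_comp, smul_smul, mul_comm]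

omit [HasExt.{w} C] in
/-- `q ^ (m + 1) • 𝟙 X = (q • 𝟙 X) ≫ (q ^ m • 𝟙 X)`. [folklore] -/
lemma pow_succ_zsmul_id (q : ℤ) (m : ℕ) :
    (q ^ (m + 1)) • 𝟙 X = (q • 𝟙 X) ≫ ((q ^ m) • 𝟙 X) := by
  rw [zsmul_id_comp_zsmul_id, ← pow_succ]

omit [HasExt.{w} C] in
/-- `q ^ m' • 𝟙 X = (q ^ (m' - m) • 𝟙 X) ≫ (q ^ m • 𝟙 X)` for `m ≤ m'`. [folklore] -/
lemma pow_zsmul_id_eq_comp {m m' : ℕ} (q : ℤ) (h : m ≤ m') :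
    (q ^ m') • 𝟙 X = ((q ^ (m' - m)) • 𝟙 X) ≫ ((q ^ m) • 𝟙 X) := by
  rw [zsmul_id_comp_zsmul_id, ← pow_add, Nat.add_sub_cancel' h]

omit [HasExt.{w} C] in
/-- If `q • 𝟙 X` is a monomorphism (`X` has no `q`-torsion) then so is `q ^ m • 𝟙 X`.
[folklore] -/
lemma mono_pow_zsmul_id (q : ℤ) (hq : Mono (q • 𝟙 X)) (m : ℕ) : Mono ((q ^ m) • 𝟙 X) := by
  induction m with
  | zero => rw [pow_zero, one_smul]; infer_instance
  | succ m ih => rw [pow_succ_zsmul_id]; exact mono_comp _ _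

omit [HasExt.{w} C] in
/-- No `q`-torsion implies no `qᵐ`-torsion (in any additive commutative group). [folklore] -/
lemma pow_smul_eq_zero_imp {M : Type*} [AddCommGroup M] (q : ℤ)
    (h : ∀ x : M, q • x = 0 → x = 0) (m : ℕ) (x : M) (hx : (q ^ m) • x = 0) : x = 0 := by
  induction m generalizing x with
  | zero => simpa using hx
  | succ m ih =>
    rw [pow_succ, mul_smul] at hx
    exact h x (ih (q • x) hx)

omit [HasExt.{w} C] in
/-- The quotient `X/qX = cokernel (q • 𝟙 X)` is killed by `q`: `q • 𝟙 (X/qX) = 0`. [folklore] -/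
lemma zsmul_id_cokernel_eq_zero (q : ℤ) : q • 𝟙 (cokernel (q • 𝟙 X)) = 0 := by
  rw [← cancel_epi (cokernel.π (q • 𝟙 X)), comp_zero, Preadditive.comp_zsmul, Category.comp_id]
  calc q • cokernel.π (q • 𝟙 X) = (q • 𝟙 X) ≫ cokernel.π (q • 𝟙 X) := by
        rw [Preadditive.zsmul_comp, Category.id_comp]
    _ = 0 := cokernel.condition _

/-- `Extⁿ(A, X/qX)` is killed by `q` (no hypothesis on `X`). [folklore] -/
lemma zsmul_ext_cokernel_eq_zero (q : ℤ) (y : Ext A (cokernel (q • 𝟙 X)) n) : q • y = 0 := by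
  rw [← comp_mk₀_zsmul_id, zsmul_id_cokernel_eq_zero, Ext.mk₀_zero, Ext.comp_zero]

/-- `Extⁿ(A, X/qᵐX)` is killed by `qᵐ` (no hypothesis on `X`): the targets of the obstruction /
Bockstein maps along a `p`-adic tower are `p`-primary torsion groups. [folklore] -/
lemma pow_zsmul_ext_cokernel_eq_zero (q : ℤ) (m : ℕ)
    (y : Ext A (cokernel ((q ^ m) • 𝟙 X)) n) : (q ^ m) • y = 0 :=
  zsmul_ext_cokernel_eq_zero A X (q ^ m) y

/-- The kernel of `Extⁿ(A, X) → Extⁿ(A, X/qᵐX)` is exactly `qᵐ · Extⁿ(A, X)` (no hypothesis on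
`Extⁿ⁺¹`; needs `q • 𝟙 X` mono). [folklore] -/
lemma comp_mk₀_cokernel_π_pow_eq_zero_iff (q : ℤ) (hq : Mono (q • 𝟙 X)) (m : ℕ)
    (x : Ext A X n) :
    haveI := mono_pow_zsmul_id X q hq m
    x.comp (Ext.mk₀ (cokernel.π ((q ^ m) • 𝟙 X))) (add_zero n) = 0 ↔
      ∃ x' : Ext A X n, (q ^ m) • x' = x := by
  haveI := mono_pow_zsmul_id X q hq m
  rw [comp_mk₀_cokernel_π_eq_zero_iff]
  simp_rw [comp_mk₀_zsmul_id]

/-- **`Extⁿ(A, X) ↠ Extⁿ(A, X/qᵐX)`.** If `X` has no `q`-torsion (`q • 𝟙 X` mono) and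
`Extⁿ⁺¹(A, X)` has no `q`-torsion, then every class in `Extⁿ(A, X/qᵐX)` lifts to `Extⁿ(A, X)`;
with `comp_mk₀_cokernel_π_pow_eq_zero_iff`, `Extⁿ(A, X/qᵐX) ≅ Extⁿ(A, X)/qᵐ`
(Bloch–Esnault–Kerz 2014, §8; Berthelot–Ogus 1983, proof of Thm. 3.8, for `H^b(X_m, 𝒪)`).
[folklore] -/
lemma comp_mk₀_cokernel_π_pow_surjective (q : ℤ) (hq : Mono (q • 𝟙 X))
    (htf : ∀ x : Ext A X (n + 1), q • x = 0 → x = 0) (m : ℕ) :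
    haveI := mono_pow_zsmul_id X q hq m
    Function.Surjective
      (fun x : Ext A X n => x.comp (Ext.mk₀ (cokernel.π ((q ^ m) • 𝟙 X))) (add_zero n)) := by
  haveI := mono_pow_zsmul_id X q hq m
  refine comp_mk₀_cokernel_π_surjective_of_injective ((q ^ m) • 𝟙 X) A ?_
  exact (comp_mk₀_zsmul_id_injective_iff A X (q ^ m)).2 (pow_smul_eq_zero_imp q htf m)

/-- **Transition maps are onto.** Under the same hypotheses, for `m ≤ m'` and ANY morphism
`t : X/q^{m'}X ⟶ X/qᵐX` compatible with the two projections (e.g. the canonical `cokernel.desc`),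
`Extⁿ(A, X/q^{m'}X) → Extⁿ(A, X/qᵐX)` is onto: the tower `(Extⁿ(A, X/qᵐX))_m` has surjective
transition maps (Bloch–Esnault–Kerz 2014, §8). [folklore] -/
lemma comp_mk₀_transition_pow_surjective (q : ℤ) (hq : Mono (q • 𝟙 X))
    (htf : ∀ x : Ext A X (n + 1), q • x = 0 → x = 0) {m m' : ℕ} (_hmm' : m ≤ m')
    (t : cokernel ((q ^ m') • 𝟙 X) ⟶ cokernel ((q ^ m) • 𝟙 X))
    (fac : cokernel.π ((q ^ m') • 𝟙 X) ≫ t = cokernel.π ((q ^ m) • 𝟙 X)) :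
    Function.Surjective (fun y' : Ext A (cokernel ((q ^ m') • 𝟙 X)) n =>
      y'.comp (Ext.mk₀ t) (add_zero n)) := by
  haveI := mono_pow_zsmul_id X q hq m
  refine comp_mk₀_surjective_of_fac ((q ^ m) • 𝟙 X) A (cokernel.π _) t fac ?_
  exact (comp_mk₀_zsmul_id_injective_iff A X (q ^ m)).2 (pow_smul_eq_zero_imp q htf m)

omit [HasExt.{w} C] in
/-- The canonical transition map `X/q^{m'}X ⟶ X/qᵐX` for `m ≤ m'` exists (it is
`cokernel.desc _ (cokernel.π _) _`; stated as an existence so that this file declares no data).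
[folklore] -/
lemma exists_transition_pow (q : ℤ) {m m' : ℕ} (hmm' : m ≤ m') :
    ∃ t : cokernel ((q ^ m') • 𝟙 X) ⟶ cokernel ((q ^ m) • 𝟙 X),
      cokernel.π ((q ^ m') • 𝟙 X) ≫ t = cokernel.π ((q ^ m) • 𝟙 X) :=
  ⟨cokernel.desc _ (cokernel.π _) (by
    rw [pow_zsmul_id_eq_comp X q hmm', Category.assoc, cokernel.condition, comp_zero]),
    cokernel.π_desc _ _ _⟩

end Scalar

/-! ## 3. Sheaf cohomology `Sheaf.H` of an abelian sheaf without `q`-torsion -/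

section Sheaf

variable {C₀ : Type u} [Category.{v} C₀] {J : GrothendieckTopology C₀}
  [HasSheafify J AddCommGrpCat.{w}] [HasExt.{w'} (Sheaf J AddCommGrpCat.{w})]
  (F : Sheaf J AddCommGrpCat.{w}) {n : ℕ}

/-- `Sheaf.H.map (q • 𝟙 F) n` is multiplication by `q` on `Hⁿ(F)`. [folklore] -/
lemma Sheaf.H.map_zsmul_id (q : ℤ) (x : F.H n) : Sheaf.H.map (q • 𝟙 F) n x = q • x :=
  comp_mk₀_zsmul_id _ F q x

/-- `Hⁿ(F/qᵐF)` is killed by `qᵐ`, where `F/qᵐF = cokernel (qᵐ • 𝟙 F)` (no hypothesis on `F`).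
[folklore] -/
lemma Sheaf.H.pow_zsmul_cokernel_eq_zero (q : ℤ) (m : ℕ)
    (y : (cokernel ((q ^ m) • 𝟙 F)).H n) : (q ^ m) • y = 0 :=
  pow_zsmul_ext_cokernel_eq_zero _ F q m y

/-- The kernel of `Hⁿ(F) → Hⁿ(F/qᵐF)` is `qᵐ · Hⁿ(F)` when `F` has no `q`-torsion. [folklore] -/
lemma Sheaf.H.map_cokernel_π_pow_eq_zero_iff (q : ℤ) (hq : Mono (q • 𝟙 F)) (m : ℕ)
    (x : F.H n) :
    haveI := mono_pow_zsmul_id F q hq m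
    Sheaf.H.map (cokernel.π ((q ^ m) • 𝟙 F)) n x = 0 ↔ ∃ x' : F.H n, (q ^ m) • x' = x :=
  comp_mk₀_cokernel_π_pow_eq_zero_iff _ F q hq m x

/-- **`Hⁿ(F) ↠ Hⁿ(F/qᵐF)`** when `F` and `Hⁿ⁺¹(F)` have no `q`-torsion ("cohomology and base
change along the `q`-adic tower": `Hⁿ(F/qᵐF) = Hⁿ(F)/qᵐ`; Bloch–Esnault–Kerz 2014, §8;
Berthelot–Ogus 1983, proof of Thm. 3.8). [folklore] -/
lemma Sheaf.H.map_cokernel_π_pow_surjective (q : ℤ) (hq : Mono (q • 𝟙 F))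
    (htf : ∀ x : F.H (n + 1), q • x = 0 → x = 0) (m : ℕ) :
    haveI := mono_pow_zsmul_id F q hq m
    Function.Surjective (Sheaf.H.map (cokernel.π ((q ^ m) • 𝟙 F)) n) :=
  comp_mk₀_cokernel_π_pow_surjective _ F q hq htf m

/-- **Surjective transition maps `Hⁿ(F/q^{m'}F) ↠ Hⁿ(F/qᵐF)`** (`m ≤ m'`, any `t` compatible with
the projections) when `F` and `Hⁿ⁺¹(F)` have no `q`-torsion: all Bocksteins of the tower vanish
(Bloch–Esnault–Kerz 2014, §8). [folklore] -/
lemma Sheaf.H.map_transition_pow_surjective (q : ℤ) (hq : Mono (q • 𝟙 F))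
    (htf : ∀ x : F.H (n + 1), q • x = 0 → x = 0) {m m' : ℕ} (hmm' : m ≤ m')
    (t : cokernel ((q ^ m') • 𝟙 F) ⟶ cokernel ((q ^ m) • 𝟙 F))
    (fac : cokernel.π ((q ^ m') • 𝟙 F) ≫ t = cokernel.π ((q ^ m) • 𝟙 F)) :
    Function.Surjective (Sheaf.H.map t n) :=
  comp_mk₀_transition_pow_surjective _ F q hq htf hmm' t fac

end Sheaf

end Literature.Algebra.Homology
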